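import Mathlib
import HarnessLib
import Literature.MathematicalPhysics.StatisticalMechanics.RelevantProjectionContraction
import Literature.MathematicalPhysics.StatisticalMechanics.RenormalisationStepTranslation

/-!
# Translation covariance of `Π₂` ([ABKM19] Definition 8.6): `Π₂` of a translated functional on the
# translated block, with the translated base point, has the same coefficients

For the renormalisation map the relevant part `Π₂ R_{k+1}K(B)` is read off at a reference block
`B₀` (`RenormalisationMap.nextH`); for translation-invariant `K` this is no loss: with
`τ_a φ = φ(· − a)` (`fieldShift a`), `B = B₀ + a`, base point `c + a`,

`Pi2 (c + a) (B₀ + a) (F ∘ τ_{−a}) = Pi2 c B₀ F`        (`Pi2_translate`),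

because the test polynomials, the linear system `(8.47)` and the Taylor data of `F` all move
together.  Consequently `Pi2Rem (c + a) (B₀ + a) (F ∘ τ_{−a}) = (Pi2Rem c B₀ F) ∘ τ_{−a}`
(`Pi2Rem_translate`).

* `fieldShiftCLE a` — `τ_a` as a continuous linear automorphism of field space;
* `relCoord_add_add`, `polyField_add_eq_fieldShift`, `linSysMat_translate`, `linSysInv_translate`;
* **`Pi2_translate`**, **`Pi2Rem_translate`**.

Everything is proved; no named fact.

## References
* S. Adams, S. Buchholz, R. Kotecký, S. Müller, arXiv:1910.13564, Definition 8.6, (8.44)–(8.47),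
  Lemma 6.4 (1) (translation invariance of the step) [AdamsBuchholzKoteckyMuller2019].
-/

noncomputable section

namespace Literature.MathematicalPhysics.StatisticalMechanics.GradientRG

open Finset
open Literature.MathematicalPhysics.StatisticalMechanics.TorusPolymer (card_translate)

variable {𝕜 : Type*} [NormedField 𝕜] [NormedAlgebra ℝ 𝕜] {d M : ℕ} [NeZero M]

/-! ## `τ_a` as a continuous linear equivalence -/

/-- `τ_a φ = φ(· − a)` as a continuous linear automorphism of `ℝ^Λ`.
[cite: AdamsBuchholzKoteckyMuller2019, Ch. 6.2] -/
def fieldShiftCLE (a : Fin d → ZMod M) : ((Fin d → ZMod M) → ℝ) ≃L[ℝ] ((Fin d → ZMod M) → ℝ) :=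
  (LinearEquiv.funCongrLeft ℝ ℝ (Equiv.subRight a)).toContinuousLinearEquiv

/-- `fieldShiftCLE a` is `fieldShift a` as a function. [cite: AdamsBuchholzKoteckyMuller2019, Ch. 6.2] -/
@[simp] theorem fieldShiftCLE_apply (a : Fin d → ZMod M) (φ : (Fin d → ZMod M) → ℝ) :
    fieldShiftCLE a φ = fieldShift a φ := by
  funext x; rfl

/-- `fieldShiftCLE a` coerces to `fieldShift a`. [cite: AdamsBuchholzKoteckyMuller2019, Ch. 6.2] -/
theorem coe_fieldShiftCLE (a : Fin d → ZMod M) :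
    ((fieldShiftCLE a : ((Fin d → ZMod M) → ℝ) ≃L[ℝ] ((Fin d → ZMod M) → ℝ)) :
      ((Fin d → ZMod M) → ℝ) → ((Fin d → ZMod M) → ℝ)) = fieldShift a :=
  funext (fieldShiftCLE_apply a)

/-! ## The test polynomials and the linear system move with the base point -/

omit [NeZero M] in
/-- `z_{c+a}(x+a) = z_c(x)`. [cite: AdamsBuchholzKoteckyMuller2019, Ch. 8.4] -/
theorem relCoord_add_add (c x a : Fin d → ZMod M) (i : Fin d) :
    relCoord (c + a) (x + a) i = relCoord c x i := by
  simp [relCoord, add_sub_add_right_eq_sub]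

omit [NeZero M] in
/-- `b^{c+a}_α = τ_a b^c_α`. [cite: AdamsBuchholzKoteckyMuller2019, Ch. 8.4 (8.35)] -/
theorem polyField_add_eq_fieldShift (c a : Fin d → ZMod M) (α : Fin d → ℕ) :
    polyField (c + a) α = fieldShift a (polyField c α) := by
  funext y
  rw [fieldShift_apply, polyField, polyField]
  refine Finset.prod_congr rfl fun i _ => ?_
  have := relCoord_add_add c (y - a) a i
  rw [sub_add_cancel] at this
  rw [this]

omit [NeZero M] in
/-- The linear system is translation invariant: `B_{c+a, B+a} = B_{c, B}`.
[cite: AdamsBuchholzKoteckyMuller2019, Ch. 8.4 (8.47)] -/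
theorem linSysMat_translate (c a : Fin d → ZMod M) (B : Finset (Fin d → ZMod M)) :
    linSysMat (c + a) (TorusPolymer.translate a B) = linSysMat c B := by
  ext α' α
  simp only [linSysMat]
  split_ifs with h
  · unfold TorusPolymer.translate
    rw [Finset.sum_image fun x _ x' _ h => add_right_cancel h]
    refine Finset.sum_congr rfl fun x _ => ?_
    rw [polyField_add_eq_fieldShift, fieldShift_apply, add_sub_cancel_right]
  · rfl

omit [NeZero M] in
/-- So is its inverse. [cite: AdamsBuchholzKoteckyMuller2019, Ch. 8.4 (8.52)] -/
theorem linSysInv_translate (c a : Fin d → ZMod M) (B : Finset (Fin d → ZMod M)) :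
    linSysInv (c + a) (TorusPolymer.translate a B) = linSysInv c B := by
  unfold linSysInv linSysNil
  rw [linSysMat_translate, card_translate]

/-! ## `Π₂` and translations -/

/-- **Translation covariance of `Π₂`**: `Pi2 (c + a) (B + a) (F ∘ τ_{−a}) = Pi2 c B F`.
[cite: AdamsBuchholzKoteckyMuller2019, Definition 8.6, Lemma 6.4 (1)] -/
theorem Pi2_translate (c a : Fin d → ZMod M) (B : Finset (Fin d → ZMod M))
    (F : ((Fin d → ZMod M) → ℝ) → 𝕜) :
    Pi2 (c + a) (TorusPolymer.translate a B) (fun φ => F (fieldShift (-a) φ)) = Pi2 c B F := by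
  -- the Taylor data of `F ∘ τ_{−a}` at `0`
  set S := fieldShiftCLE (d := d) (M := M) (-a) with hS
  have hF : (fun φ => F (fieldShift (-a) φ)) = F ∘ S := by
    funext φ; simp [hS]
  have hS0 : S 0 = 0 := map_zero S
  have hk0 : F (fieldShift (-a) 0) = F 0 := rfl
  have hk1 : fderiv ℝ (fun φ => F (fieldShift (-a) φ)) 0 = (fderiv ℝ F 0).comp (S : _ →L[ℝ] _) := by
    rw [hF, ContinuousLinearEquiv.comp_right_fderiv, hS0]
  have hk2 : iteratedFDeriv ℝ 2 (fun φ => F (fieldShift (-a) φ)) 0 =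
      (iteratedFDeriv ℝ 2 F 0).compContinuousLinearMap fun _ => (S : _ →L[ℝ] _) := by
    have h := S.iteratedFDerivWithin_comp_right F uniqueDiffOn_univ (x := 0) (Set.mem_univ _) 2
    rw [Set.preimage_univ, iteratedFDerivWithin_univ, iteratedFDerivWithin_univ, hS0] at h
    rw [hF]; exact h
  -- `τ_{−a}` undoes the shift of the test polynomials
  have hpoly : ∀ α : Fin d → ℕ, S (polyField (c + a) α) = polyField c α := by
    intro α
    rw [hS, fieldShiftCLE_apply, polyField_add_eq_fieldShift, fieldShift_fieldShift, add_neg_cancel,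
      fieldShift_zero]
  funext ι
  rw [Pi2, Pi2, hk0, hk1, hk2]
  rcases ι with u | α | q
  · simp only [Pi2Data, card_translate]
  · simp only [Pi2Data, linSysInv_translate, ContinuousLinearMap.comp_apply, ContinuousLinearEquiv.coe_coe,
      hpoly]
  · simp only [Pi2Data, card_translate, ContinuousMultilinearMap.compContinuousLinearMap_apply,
      ContinuousLinearEquiv.coe_coe]
    congr 2
    funext i
    fin_cases i <;> simp [hpoly]

/-- **Translation covariance of the remainder**: `Pi2Rem (c+a) (B+a) (F ∘ τ_{−a}) = (Pi2Rem c B F) ∘ τ_{−a}`.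
[cite: AdamsBuchholzKoteckyMuller2019, Definition 8.6, Lemma 6.4 (1)] -/
theorem Pi2Rem_translate (c a : Fin d → ZMod M) (B : Finset (Fin d → ZMod M))
    (F : ((Fin d → ZMod M) → ℝ) → 𝕜) (φ : (Fin d → ZMod M) → ℝ) :
    Pi2Rem (c + a) (TorusPolymer.translate a B) (fun φ => F (fieldShift (-a) φ)) φ =
      Pi2Rem c B F (fieldShift (-a) φ) := by
  simp only [Pi2Rem, Pi.sub_apply, Pi2_translate]
  congr 1
  have := eval_translate_fieldShift (Pi2 c B F) a B (fieldShift (-a) φ)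
  rw [fieldShift_fieldShift, neg_add_cancel, fieldShift_zero] at this
  exact this

end Literature.MathematicalPhysics.StatisticalMechanics.GradientRG

end
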